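import Summits.Ventures.PercRepro2.CaseOneGadgetUWOBAnchorT

/-!
# The residual core with the marks-only anchor: the statement vertex has an unmarked neighbour
(blind cell PercRepro2, p1 g32)

Every statement vertex all of whose edges go to marks is six-form closed (`closedAtT_of_marksOnly`,
CaseOneStarMainT), so the marks-only vertices join the anchor set of the six-form calculus:
`ClosedAnchorTM := ClosedAnchor ∨ MarksOnlyAnchor`, **`closedAtT_of_closedAnchorTM`**, the `a₂`-free
residual core `InCoreTM` relative to it and the reduction **`closedAtT_of_coreTM`** /
`closedAt_of_coreTM`. What this buys: on every `InCoreTM` instance the statement vertex has an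
UNMARKED neighbour (**`InCoreTM.exists_unmarked_edge`**) and no `a₂`-edge (`InCoreTM.no_a2_edge`) —
the honest frontier of S5 in the six-form calculus is a residual instance whose statement vertex sees
an unmarked vertex, no `a₂`, and is not reachable by the moves of the lane from any closed anchor or
marks-only vertex. Own code; standard axioms. -/

namespace Summit.Ventures.PercRepro2

namespace CaseOne

universe u

section AnchorsTM
variable {V : Type*}

/-- The marks-only anchor: every edge at `v` goes to one of the four marks (no condition on
multiplicities or on coincidences among the marks; `v` itself may be a mark). -/
def MarksOnlyAnchor (o a₁ a₂ b : V) (E : Type u) (ends : E → Sym2 V) (v : V) : Prop :=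
  ∀ e, v ∈ ends e → ends e = s(a₁, v) ∨ ends e = s(a₂, v) ∨ ends e = s(o, v) ∨ ends e = s(b, v)

/-- **The anchors of the six-form calculus with the marks-only vertices**: a closed anchor of the
four-form calculus or a marks-only statement vertex. -/
def ClosedAnchorTM (o a₁ a₂ b : V) (E : Type u) (ends : E → Sym2 V) (v : V) : Prop :=
  ClosedAnchor o a₁ a₂ b E ends v ∨ MarksOnlyAnchor o a₁ a₂ b E ends v

variable (o a₁ a₂ b : V) [Fintype V] [DecidableEq V] {R : Type*} [Field R] [LinearOrder R]
  [IsStrictOrderedRing R]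

/-- **A `ClosedAnchorTM` anchor is six-form closed.** -/
theorem closedAtT_of_closedAnchorTM (E : Type u) [Fintype E] [DecidableEq E] (ends : E → Sym2 V)
    (v : V) (h : ClosedAnchorTM o a₁ a₂ b E ends v) : ClosedAtT (R := R) o a₁ a₂ b E ends v := by
  rcases h with h | h
  · exact closedAtT_of_closedAnchor o a₁ a₂ b E ends v h
  · exact closedAtT_of_marksOnly h

variable (v : V)

/-- **The `a₂`-free residual core relative to `ClosedAnchorTM`.** -/
def InCoreTM (E : Type u) [Fintype E] [DecidableEq E] (ends : E → Sym2 V) : Prop :=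
  InCoreTAnc o a₁ a₂ b v (fun E₀ _ _ ends₀ v₀ => ClosedAnchorTM o a₁ a₂ b E₀ ends₀ v₀) E ends

/-- **The reduction to the `a₂`-free residual core with the marks-only anchor**: the six forms for every
weight vector on every `InCoreTM` instance give them on every finite graph. -/
theorem closedAtT_of_coreTM
    (hcore : ∀ (E' : Type u) [Fintype E'] [DecidableEq E'] (ends' : E' → Sym2 V),
      InCoreTM o a₁ a₂ b v E' ends' → ClosedAtT (R := R) o a₁ a₂ b E' ends' v) :
    ∀ (E : Type u) [Fintype E] [DecidableEq E] (ends : E → Sym2 V),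
      ClosedAtT (R := R) o a₁ a₂ b E ends v :=
  closedAtT_of_coreTAnc o a₁ a₂ b v _
    (fun E₀ _ _ ends₀ v₀ h => closedAtT_of_closedAnchorTM o a₁ a₂ b E₀ ends₀ v₀ h) hcore

/-- **The four forms everywhere from the six forms on `InCoreTM`.** -/
theorem closedAt_of_coreTM
    (hcore : ∀ (E' : Type u) [Fintype E'] [DecidableEq E'] (ends' : E' → Sym2 V),
      InCoreTM o a₁ a₂ b v E' ends' → ClosedAtT (R := R) o a₁ a₂ b E' ends' v)
    (E : Type u) [Fintype E] [DecidableEq E] (ends : E → Sym2 V) : ClosedAt R o a₁ a₂ b E ends v :=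
  closedAt_of_closedAtT (closedAtT_of_coreTM o a₁ a₂ b v hcore E ends)

end AnchorsTM

section CoreTMProps
variable {V : Type*} (o a₁ a₂ b v : V)

/-- An `InCoreTM` instance is an `InCoreTU` instance (the anchor set only grew). -/
theorem InCoreTU.of_inCoreTM (E : Type u) [Fintype E] [DecidableEq E] (ends : E → Sym2 V)
    (h : InCoreTM o a₁ a₂ b v E ends) : InCoreTU o a₁ a₂ b v E ends := by
  obtain ⟨hres, ha2, hreach⟩ := h
  refine ⟨hres, ha2, fun hr => hreach ?_⟩
  obtain ⟨E₀, _, _, ends₀, v₀, hanc, hmv⟩ := hr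
  exact ⟨E₀, inferInstance, inferInstance, ends₀, v₀, Or.inl hanc, hmv⟩

/-- On an `InCoreTM` instance there is no edge `{a₂, v}` at the statement vertex. -/
theorem InCoreTM.no_a2_edge (E : Type u) [Fintype E] [DecidableEq E] (ends : E → Sym2 V)
    (h : InCoreTM o a₁ a₂ b v E ends) : ∀ e, ends e ≠ s(a₂, v) :=
  h.2.1

/-- **On an `InCoreTM` instance the statement vertex has an unmarked neighbour**: an edge at `v` that
is not an edge to `a₁`, `a₂`, `o` or `b` — otherwise the instance is a marks-only anchor, reachable
from itself by no move. -/
theorem InCoreTM.exists_unmarked_edge (E : Type u) [Fintype E] [DecidableEq E] (ends : E → Sym2 V)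
    (h : InCoreTM o a₁ a₂ b v E ends) :
    ∃ e, v ∈ ends e ∧ ends e ≠ s(a₁, v) ∧ ends e ≠ s(a₂, v) ∧ ends e ≠ s(o, v) ∧ ends e ≠ s(b, v) := by
  by_contra hno
  refine h.2.2 ⟨E, inferInstance, inferInstance, ends, v, Or.inr fun e he => ?_, MovesQ.refl E ends v⟩
  by_cases h1 : ends e = s(a₁, v)
  · exact Or.inl h1
  by_cases h2 : ends e = s(a₂, v)
  · exact Or.inr (Or.inl h2)
  by_cases ho : ends e = s(o, v)
  · exact Or.inr (Or.inr (Or.inl ho))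
  by_cases hb : ends e = s(b, v)
  · exact Or.inr (Or.inr (Or.inr hb))
  exact absurd ⟨e, he, h1, h2, ho, hb⟩ hno

end CoreTMProps

end CaseOne

end Summit.Ventures.PercRepro2
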